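import Summits.HodgeConjecture.HodgeConjecture.Theorems.Ring2HypothesesWeilComponentsLadder
import Summits.HodgeConjecture.HodgeConjecture.Theorems.Ring2HypothesesFamilies
import Literature.AlgebraicGeometry.HodgeTheory.MaximalPicardNumberHodgeClasses
import Literature.AlgebraicGeometry.Milne1999.CMTypeSimpleIsogenyFactors
import Literature.AlgebraicGeometry.Milne1999.CodesHCOfCMHodgeHypothesis
import Literature.NumberTheory.DiophantineGeometry.AVIsogenyTateFreeHomProofs
import Literature.AlgebraicGeometry.Motives.AbelianVarietyDimZeroProofs
import HarnessLib

/-!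
# Ring 2 — hypotheses layer, part VIII: the CM-POWER anchor (fibres isogenous to `Eᴺ⁺¹`, `E` a CM elliptic curve)

HONEST FRAMING: research route conditional on HC_CM; not a corollary; Q11.4-sentence-2 already refuted in dim ≥ 3.

Cell `pub-hodge-ring2`, seat `pub-hodge-ring2-typer2`, gen 6. `HC_CM` is ALWAYS the binder
`(hCM : Theses.RankFourFaces.CMAbelianHodge)` (stmt-HodgeConjecture-3052), never an axiom, never cited as known —
and the point of this part is the set of rows in which it is NOT EVEN A BINDER: at an anchor fibre presented by
an abelian variety isogenous to a power `Eᴺ⁺¹` of an elliptic curve with complex multiplication, `HC_CM` is a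
THEOREM of the tree (Tate 1965 / Murasaki / van Geemen LNM 1594 Thm. 4.3, landed by the Literature seat as
`EllipticCurve.hodgeConjectureFor_of_isIsogenous_powSucc_of_cm`, p188750), and such a fibre IS a CM point
(`EllipticCurve.isOfCMType_of_cm`, proved here: `ℚ[ψ] ≅ ℚ(√-d) ⊂ End⁰(E)` is a reduced commutative subalgebra
of degree `2 = 2·dim E`; products by `Milne1999.IsOfCMType.prod`; isogeny invariance by
`Milne1999.isOfCMType_iff_of_isIsogenous`). Nothing here proves a new case of the Hodge conjecture: every row is
an implication between NAMED typed statements, or Tate's theorem moved along a chart; sorry-free; axioms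
`propext`, `Classical.choice`, `Quot.sound`. Companions: part V `Ring2HypothesesFamilies` (anchor locus, engine),
part VII-A/B `Ring2HypothesesWeilComponents[Ladder]` (δ-components, abstract-anchor engine, T6).

## What this file types

* `cmPowerAnchor n` — anchor predicate (schema of part VII-A): the marked fibre is charted by an abelian
  `2n`-fold `A₀` ISOGENOUS to `Eᴺ⁺¹`, `E` an elliptic curve with `ψ ≫ ψ = -d'`, `d' ≥ 1`. In print: the member
  `E_Kⁿ × E_Kⁿ` of the `n²`-dimensional Weil family, or any product of elliptic curves with CM by `K` (all
  isogenous to `E_K`). LOCATOR HONESTY: van Geemen does not single out these members in words; that they lie on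
  the families is this file's one-line INFERENCE from his construction — in 5.12 (`K = ℚ(i)`, `det H = 1`, family
  over `H_A`) the point `τ = i·I` lies in `H_A` and its member `ℂ²ⁿ/(ℤ²ⁿ + iℤ²ⁿ)` is `E_i^{2n}`; in general (5.5–5.8:
  members ↔ `V₊ ⊂ (V_ℝ, i)` with `H|V₊ > 0`) an `H`-orthogonal `K`-basis (Hermitian forms diagonalise over `K`;
  signature `(n,n)`) gives a `K`-RATIONAL positive `V₊`, whose member splits up to isogeny as
  `(V₊,ℝ, i)/Λ₊ × (V₋,ℝ, -i)/Λ₋ ~ E_Kⁿ × E_Kⁿ`, on every `(d, n, det H)`. Inference, not a printed sentence.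
* `cmPowerLocus f n ⊆ S(ℂ)` — the per-family form (part V schema): fibres charted by such an `A₀`.
* `CMPowerPointedWeilFamiliesComponent n d δ := PointedWeilFamiliesComponent n d δ (cmPowerAnchor n)` — the
  family-supply leaf of the component `(ℚ(√-d), 2n, δ)` pointed at a CM-power member (typed missing input; in
  print for the components that contain an `E_K`-power member; NOT claimed for every `δ`).

## Rows (kernel-checked)

| row | theorem | inputs | honest column |
|---|---|---|---|
| V8 | `cmPowerAnchor_valid` | — | the anchor is VALID WITHOUT `HC_CM`: Tate's theorem along the chart and the isogeny |
| C8 | `cmAnchor_of_cmPowerAnchor`, `cmPowerLocus_subset_cmLocus` | — | a CM-power fibre IS a CM point (`isOfCMType_of_cm`, `.prod`, isogeny invariance) |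
| A8 | `cmPowerLocus_subset_anchorLocus`, `cmHodgeHypothesisAt_of_isIsogenous_powSucc_of_cm` | — | `HC_CM` restricted to CM-power abelian varieties is a THEOREM; part V's `cmLocus ⊆ anchorLocus` needs `HC_CM` only OFF the CM-power locus |
| W1‴ | `weilClassesComponent_of_cmPowerPointed` | `CMPowerPointedWeilFamiliesComponent`, `WeilVariationalHodgeComponent` | row W1 of part VII-A with `HC_CM` DISCHARGED (not dropped: proved at the anchor); content = the δ-restricted variational statement, OPEN, + the pointed family leaf |
| W6‴ | `hodgeGeneralWeilTypeComponent_of_cmPowerPointed` | the same + `VanGeemen1994_thm612`, `0 < n`, `0 < d` | T6 of the component, `HC_CM`-free |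
| D8 | `hodgeConjectureFor_of_invariantCycles_on_cmPowerAnchored_families_through`, `hodgeConjectureFor_fiber_of_invariantCycles_of_cmPowerLocus_of_extend` | per-`A` families through `A` (resp. one family and its Hodge-generic fibres) with a CM-power fibre and (1.1) | part VI's `…_of_HC_CM_of_invariantCycles_on_families_through` / (D1) with `HC_CM` discharged; content = (1.1), OPEN |
| — | `cmPointedWeilFamiliesComponent_of_cmPowerPointed`, `anchoredWeilFamiliesComponent_of_cmPowerPointed` | nothing | bookkeeping: CM-power-pointed ⟹ CM-pointed AND ⟹ anchored, both `HC_CM`-free |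

RELATION TO W1′ (`DivisorGeneratedCMPointedWeilFamiliesComponent`, part VII-A): both leaves remove `HC_CM`; they
are INCOMPARABLE as typed — W1′ asks `Hdg = Div` on the chart `A₀` itself (true for `A₀ = Eᴺ⁺¹` by
`EllipticCurve.hodgeClasses_divisorial_powSucc_of_cm`, but the tree has no transport of `divisorClassesSpan`
along an isogeny), W1‴ asks an isogeny to `Eᴺ⁺¹` (false for divisor-generated simple CM charts). At the diagonal
member `A₀ = E_K^{2n}` both hold (`divisorGeneratedCMAnchor_of_powSucc`).

PRINT STATUS / FRESHNESS (RING2-MAP §hypotheses gen 6, FRESHNESS.md typer2 gen 6): Tate's theorem is 1965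
(unpublished) / Murasaki / Hazama; the Weil families and their `E_K`-power members are Weil 1977, van Geemen
1994 §5; no 2020–2026 item changes the status of the δ-restricted variational statement (OPEN for `n ≥ 4` and
for the non-split sixfold components). WHAT THE KERNEL ROWS ADD about Hodge classes: NOTHING new — W1‴ says
precisely that on a component containing an `E_K`-power member the ONLY open input of Markman's two-step
strategy is the Weil-confined variational Hodge statement of that component (or its CM-germ / semiregularity
substitutes of `Ring2Transport*`).

ANTI-VACUITY: `cmPowerAnchor` is inhabited at every `E`-power (`cmPowerAnchor_powSucc`: `A₀ = Eᴺ⁺¹`, identity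
isogeny) given a CM elliptic curve `(E, ψ)`; the tree does not construct one (no `ℂ/ℤ[i]`), so existence of an
anchor fibre stays a datum of the family leaf, as in parts V–VII.
-/

noncomputable section

set_option linter.dupNamespace false

open CategoryTheory
open Literature.AlgebraicGeometry Literature.AlgebraicGeometry.Motives
open Literature.AlgebraicGeometry.HodgeTheory
open Literature.AlgebraicTopology.SingularHomology
open Literature.AlgebraicGeometry.Milne1999 (IsOfCMType CMHodgeHypothesisAt isOfCMType_iff_of_isIsogenous)
open Literature.AlgebraicGeometry.VanGeemen1994
open Literature.AlgebraicGeometry.Abdulali1994 (InvariantCyclesHoldFor)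
open Literature.Barriers.HodgeConjecture (divisorClassesSpan)
open Summit.HodgeConjecture.HodgeConjecture.WeilTypeLadder
open Summit.HodgeConjecture.HodgeConjecture.Theses
open Summit.HodgeConjecture.HodgeConjecture.Ring2Transport
open Summit.HodgeConjecture.HodgeConjecture.Ring2.Deform (cmLocus)

namespace Summit.HodgeConjecture.HodgeConjecture.Ring2.Hypotheses

/-! ## §0 An elliptic curve with complex multiplication is of CM type (`ℚ[ψ] ≅ ℚ(√-d) ⊂ End⁰(E)`) -/

namespace QuadraticOrder

variable {R : Type*} [Ring R] [Algebra ℚ R] (x : R) {d : ℚ}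

/-- `(s + t x)(s' + t' x) = (s s' - d t t') + (s t' + t s') x` when `x² = -d`. [folklore] -/
theorem pair_mul_pair (hx : x * x = -(d • (1 : R))) (s t s' t' : ℚ) :
    (s • (1 : R) + t • x) * (s' • (1 : R) + t' • x) =
      (s * s' - d * t * t') • (1 : R) + (s * t' + t * s') • x := by
  simp only [mul_add, add_mul, smul_mul_smul_comm, one_mul, mul_one, hx, smul_neg]
  module

/-- Norm identity `(s + t x)(s - t x) = s² + d t²` (`x² = -d`), conjugate on either side. [folklore] -/
theorem pair_mul_conj (hx : x * x = -(d • (1 : R))) (s t : ℚ) :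
    (s • (1 : R) + t • x) * (s • (1 : R) + (-t) • x) = (s ^ 2 + d * t ^ 2) • (1 : R) ∧
      (s • (1 : R) + (-t) • x) * (s • (1 : R) + t • x) = (s ^ 2 + d * t ^ 2) • (1 : R) := by
  constructor <;> (rw [pair_mul_pair x hx]; module)

/-- For `d > 0` a non-zero `s + t x` (`x² = -d`) is a unit, with inverse `(s - t x)/(s² + d t²)`. [folklore] -/
theorem isUnit_pair (hx : x * x = -(d • (1 : R))) (hd : 0 < d) {s t : ℚ} (hst : ¬ (s = 0 ∧ t = 0)) :
    IsUnit (s • (1 : R) + t • x) := by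
  have hq : 0 < s ^ 2 + d * t ^ 2 := by
    rcases not_and_or.1 hst with hs | ht
    · positivity
    · positivity
  obtain ⟨h1, h2⟩ := pair_mul_conj x hx s t
  refine ⟨⟨_, (s ^ 2 + d * t ^ 2)⁻¹ • (s • (1 : R) + (-t) • x), ?_, ?_⟩, rfl⟩
  · rw [mul_smul_comm, h1, smul_smul, inv_mul_cancel₀ hq.ne', one_smul]
  · rw [smul_mul_assoc, h2, smul_smul, inv_mul_cancel₀ hq.ne', one_smul]

/-- For `d > 0` and `R ≠ 0`, `1` and `x` (`x² = -d`) are `ℚ`-linearly independent. [folklore] -/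
theorem linearIndependent_one_pair [Nontrivial R] (hx : x * x = -(d • (1 : R))) (hd : 0 < d) :
    LinearIndependent ℚ ![(1 : R), x] :=
  LinearIndependent.pair_iff.2 fun _ _ hst => by
    by_contra h
    exact (isUnit_pair x hx hd h).ne_zero hst

/-- The subalgebra `ℚ[x] = ℚ·1 + ℚ·x` of `R` (`x² = -d`). [folklore] -/
def pairSubalgebra (hx : x * x = -(d • (1 : R))) : Subalgebra ℚ R :=
  (Submodule.span ℚ {(1 : R), x}).toSubalgebra (Submodule.subset_span (Set.mem_insert _ _)) (by
    intro y z hy hz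
    obtain ⟨s, t, rfl⟩ := Submodule.mem_span_pair.1 hy
    obtain ⟨s', t', rfl⟩ := Submodule.mem_span_pair.1 hz
    rw [pair_mul_pair x hx]
    exact Submodule.mem_span_pair.2 ⟨_, _, rfl⟩)

/-- Membership in `ℚ[x]`. [folklore] -/
theorem mem_pairSubalgebra_iff (hx : x * x = -(d • (1 : R))) {y : R} :
    y ∈ pairSubalgebra x hx ↔ ∃ s t : ℚ, s • (1 : R) + t • x = y :=
  Submodule.mem_toSubalgebra.trans Submodule.mem_span_pair

/-- `ℚ[x]` is commutative. [folklore] -/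
theorem pairSubalgebra_comm (hx : x * x = -(d • (1 : R))) :
    ∀ y ∈ pairSubalgebra x hx, ∀ z ∈ pairSubalgebra x hx, y * z = z * y := by
  intro y hy z hz
  obtain ⟨s, t, rfl⟩ := (mem_pairSubalgebra_iff x hx).1 hy
  obtain ⟨s', t', rfl⟩ := (mem_pairSubalgebra_iff x hx).1 hz
  rw [pair_mul_pair x hx, pair_mul_pair x hx]
  module

/-- For `d > 0` and `R ≠ 0`, `ℚ[x]` is reduced (every non-zero element is a unit). [folklore] -/
theorem pairSubalgebra_isReduced [Nontrivial R] (hx : x * x = -(d • (1 : R))) (hd : 0 < d) :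
    IsReduced (pairSubalgebra x hx) := by
  refine ⟨fun y ⟨k, hk⟩ => ?_⟩
  obtain ⟨s, t, hst⟩ := (mem_pairSubalgebra_iff x hx).1 y.2
  have hk' : (y : R) ^ k = 0 := by simpa using congrArg Subtype.val hk
  by_contra hy0
  have hst0 : ¬ (s = 0 ∧ t = 0) := by
    rintro ⟨rfl, rfl⟩
    exact hy0 (Subtype.ext (by rw [← hst]; simp))
  exact ((hst ▸ isUnit_pair x hx hd hst0).pow k).ne_zero hk'

/-- For `d > 0` and `R ≠ 0`, `[ℚ[x] : ℚ] = 2`. [folklore] -/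
theorem finrank_pairSubalgebra [Nontrivial R] (hx : x * x = -(d • (1 : R))) (hd : 0 < d) :
    Module.finrank ℚ (pairSubalgebra x hx) = 2 := by
  have hP : Submodule.span ℚ {(1 : R), x} = Submodule.span ℚ (Set.range ![(1 : R), x]) := by
    simp only [Matrix.range_cons, Matrix.range_empty, Set.union_empty, Set.singleton_union]
  rw [← Subalgebra.finrank_toSubmodule, pairSubalgebra, Submodule.toSubalgebra_toSubmodule, hP,
    finrank_span_eq_card (linearIndependent_one_pair x hx hd), Fintype.card_fin]

end QuadraticOrder

/-- `End⁰(A) ≠ 0` for `dim A > 0`: `𝟙 A ≠ 0` (`not_isIsogeny_zero_of_dim_pos`) and `End(A) ↪ End⁰(A)` in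
characteristic zero (`endAlgebra.of_injective_of_charZero`). [cite: MumfordAV1970, §19 Thm. 3 and Cor. 2] -/
theorem nontrivial_endAlgebra_of_dim_pos (A : AbelianVariety ℂ) (hA : 0 < A.dim) : Nontrivial A.endAlgebra := by
  have h1 : (𝟙 A : A ⟶ A) ≠ 0 := fun h ↦
    AbelianVariety.not_isIsogeny_zero_of_dim_pos (X := A) hA (h ▸ AbelianVariety.isIsogeny_id A)
  refine ⟨⟨1, 0, fun h10 => h1 ?_⟩⟩
  have h : AbelianVariety.endAlgebra.of A (1 : End A) = AbelianVariety.endAlgebra.of A 0 := by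
    rw [map_one, map_zero, h10]
  exact AbelianVariety.endAlgebra.of_injective_of_charZero (A := A) h

/-- **An elliptic curve with complex multiplication is of CM type** (`Milne1999.IsOfCMType`): for `dim E = 1` and
`ψ ≫ ψ = -d`, `d ≥ 1`, the subalgebra `ℚ[ψ] ⊂ End⁰(E)` is reduced, commutative and of degree `2 = 2·dim E`
(it is `≅ ℚ(√-d)`; nothing about the rest of `End⁰(E)` is used). [cite: Milne1999, §2 p. 54 (definition of CM-type)]
[cite: vanGeemen1994HodgeAV, 4.9–4.10 and 5.7 (`K ⊂ End(X)_ℚ`)] -/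
theorem EllipticCurve.isOfCMType_of_cm {E : AbelianVariety ℂ} (hE : E.dim = 1) (ψ : E ⟶ E) {d : ℕ}
    (hd : 0 < d) (hψ : ψ ≫ ψ = -(d • 𝟙 E)) : IsOfCMType E := by
  haveI : Nontrivial E.endAlgebra := nontrivial_endAlgebra_of_dim_pos E (hE ▸ one_pos)
  have hψ' : End.of ψ * End.of ψ = -(d • (1 : End E)) := hψ
  have hx : AbelianVariety.endAlgebra.of E (End.of ψ) * AbelianVariety.endAlgebra.of E (End.of ψ) =
      -((d : ℚ) • (1 : E.endAlgebra)) := by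
    rw [← map_mul, hψ', map_neg, map_nsmul, map_one, Nat.cast_smul_eq_nsmul]
  have hd' : (0 : ℚ) < d := Nat.cast_pos.2 hd
  refine ⟨QuadraticOrder.pairSubalgebra _ hx, QuadraticOrder.pairSubalgebra_isReduced _ hx hd',
    QuadraticOrder.pairSubalgebra_comm _ hx, ?_⟩
  rw [QuadraticOrder.finrank_pairSubalgebra _ hx hd', hE]

/-- Powers `Eᴺ⁺¹` of a CM abelian variety are of CM type (`IsOfCMType.prod`, induction). [cite: Milne1999, §2 p. 54] -/
theorem isOfCMType_powSucc {E : AbelianVariety ℂ} (hEcm : IsOfCMType E) : ∀ N : ℕ, IsOfCMType (E.powSucc N)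
  | 0 => hEcm
  | N + 1 => (isOfCMType_powSucc hEcm N).prod hEcm

/-- **An abelian variety isogenous to a power of a CM elliptic curve is of CM type.** [cite: Milne1999, §2 p. 54] -/
theorem isOfCMType_of_isIsogenous_powSucc_of_cm {E : AbelianVariety ℂ} (hE : E.dim = 1) (ψ : E ⟶ E) {d : ℕ}
    (hd : 0 < d) (hψ : ψ ≫ ψ = -(d • 𝟙 E)) (N : ℕ) {A : AbelianVariety ℂ} (hA : A.IsIsogenous (E.powSucc N)) :
    IsOfCMType A :=
  (isOfCMType_iff_of_isIsogenous hA).2 (isOfCMType_powSucc (EllipticCurve.isOfCMType_of_cm hE ψ hd hψ) N)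

/-- **`HC_CM` is a THEOREM at abelian varieties isogenous to a power of a CM elliptic curve** (Tate / Murasaki /
van Geemen Thm. 4.3 with Lemma 3.7, the tree's `EllipticCurve.hodgeConjectureFor_of_isIsogenous_powSucc_of_cm`).
[cite: vanGeemen1994HodgeAV, Lemma 3.7 and Thm. 4.3] [cite: Milne1999, §7 p. 72] -/
theorem cmHodgeHypothesisAt_of_isIsogenous_powSucc_of_cm {E : AbelianVariety ℂ} (hE : E.dim = 1) (ψ : E ⟶ E)
    {d : ℕ} (hd : 0 < d) (hψ : ψ ≫ ψ = -(d • 𝟙 E)) (N : ℕ) {A : AbelianVariety ℂ}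
    (hA : A.IsIsogenous (E.powSucc N)) : CMHodgeHypothesisAt A :=
  fun _ _ ↦ EllipticCurve.hodgeConjectureFor_of_isIsogenous_powSucc_of_cm hE ψ hd hψ N hA

/-! ## §1 The CM-power anchor and the CM-power locus -/

variable {𝒳 S : SchemeOver ℂ}

/-- **The CM-power anchor**: the marked fibre is charted by an abelian `2n`-fold `A₀` isogenous to `Eᴺ⁺¹`, `E` an
elliptic curve with complex multiplication `ψ`, `ψ² = -d'`, `d' ≥ 1` (schema of `Ring2HypothesesWeilComponents`:
the class argument is not used). [cite: vanGeemen1994HodgeAV, Thm. 4.3 and 5.12] -/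
def cmPowerAnchor (n : ℕ) (X : SchemeOver ℂ) (_x : complexBetti X (2 * n)) : Prop :=
  ∃ (A₀ E : AbelianVariety ℂ) (ψ : E ⟶ E) (d' N : ℕ), Nonempty (A₀.X ≅ X) ∧ A₀.dim = 2 * n ∧ E.dim = 1 ∧
    0 < d' ∧ ψ ≫ ψ = -(d' • 𝟙 E) ∧ A₀.IsIsogenous (E.powSucc N)

/-- **The CM-power locus of a family** `f : 𝒳 ⟶ S` in relative dimension `n`: the fibres charted by an abelian
`n`-fold isogenous to a power of a CM elliptic curve (schema of part V's `anchorLocus` / `Deform.cmLocus`).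
[cite: vanGeemen1994HodgeAV, Thm. 4.3 and 5.12] -/
def cmPowerLocus (f : 𝒳 ⟶ S) (n : ℕ) : Set (ComplexPoints S) :=
  {s | ∃ (A₀ E : AbelianVariety ℂ) (ψ : E ⟶ E) (d' N : ℕ), Nonempty (A₀.X ≅ fiberOver f s) ∧ A₀.dim = n ∧
    E.dim = 1 ∧ 0 < d' ∧ ψ ≫ ψ = -(d' • 𝟙 E) ∧ A₀.IsIsogenous (E.powSucc N)}

/-- The two spellings agree on a fibre (definitional). [folklore] -/
theorem cmPowerAnchor_fiber_iff (f : 𝒳 ⟶ S) (n : ℕ) (s : ComplexPoints S) (x : complexBetti (fiberOver f s) (2 * n)) :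
    cmPowerAnchor n (fiberOver f s) x ↔ s ∈ cmPowerLocus f (2 * n) :=
  Iff.rfl

/-- ANTI-VACUITY: the power `Eᴺ⁺¹` itself carries the CM-power anchor (identity chart, identity isogeny).
[cite: vanGeemen1994HodgeAV, Thm. 4.3] -/
theorem cmPowerAnchor_powSucc {E : AbelianVariety ℂ} (hE : E.dim = 1) (ψ : E ⟶ E) {d : ℕ} (hd : 0 < d)
    (hψ : ψ ≫ ψ = -(d • 𝟙 E)) (N n : ℕ) (hdim : (E.powSucc N).dim = 2 * n)
    (x : complexBetti (E.powSucc N).X (2 * n)) : cmPowerAnchor n (E.powSucc N).X x :=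
  ⟨E.powSucc N, E, ψ, d, N, ⟨Iso.refl _⟩, hdim, hE, hd, hψ, 𝟙 _, AbelianVariety.isIsogeny_id _⟩

/-- **Row V8 — the CM-power anchor is VALID WITHOUT `HC_CM`**: a rational `(n,n)` class on a fibre charted by
`A₀ ~ Eᴺ⁺¹` is algebraic — Tate's theorem on `Eᴺ⁺¹`, isogeny invariance (Lemma 3.7), transport along the chart.
[cite: vanGeemen1994HodgeAV, Lemma 3.7 and Thm. 4.3] [cite: Gordon1997, §3] -/
theorem cmPowerAnchor_valid (n : ℕ) :
    ∀ (X : SchemeOver ℂ) (x : complexBetti X (2 * n)), cmPowerAnchor n X x → IsRationalClass x →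
      IsOfHodgeType (2 * n) X (2 * n) n n x → x ∈ algebraicClasses X n := by
  rintro X x ⟨A₀, E, ψ, d', N, ⟨e₀⟩, hA₀dim, hE, hd', hψ, hiso⟩ hxQ hxH
  have hHC : HodgeConjectureFor (2 * n) X := (hodgeConjectureFor_iff_of_iso e₀).1
    (hA₀dim ▸ EllipticCurve.hodgeConjectureFor_of_isIsogenous_powSucc_of_cm hE ψ hd' hψ N hiso)
  exact hHC.2 n x hxQ hxH

/-- **Row C8 — a CM-power anchor is a CM anchor** (the fibre's chart is of CM type: §0). [cite: Milne1999, §2 p. 54] -/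
theorem cmAnchor_of_cmPowerAnchor {n : ℕ} {X : SchemeOver ℂ} {x : complexBetti X (2 * n)}
    (h : cmPowerAnchor n X x) : cmAnchor n X x := by
  obtain ⟨A₀, E, ψ, d', N, he₀, hA₀dim, hE, hd', hψ, hiso⟩ := h
  exact ⟨A₀, he₀, hA₀dim, isOfCMType_of_isIsogenous_powSucc_of_cm hE ψ hd' hψ N hiso⟩

/-- A CM-power anchor is an algebraic anchor for rational `(n,n)` classes (row V8 restated). [cite: vanGeemen1994HodgeAV, Thm. 4.3] -/
theorem algebraicAnchor_of_cmPowerAnchor {n : ℕ} {X : SchemeOver ℂ} {x : complexBetti X (2 * n)}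
    (h : cmPowerAnchor n X x) (hxQ : IsRationalClass x) (hxH : IsOfHodgeType (2 * n) X (2 * n) n n x) :
    algebraicAnchor n X x :=
  cmPowerAnchor_valid n X x h hxQ hxH

/-- **Row C8, family form — CM-power fibres are CM points**: `cmPowerLocus f n ⊆ cmLocus f n`. [cite: Milne1999, §2 p. 54] -/
theorem cmPowerLocus_subset_cmLocus (f : 𝒳 ⟶ S) (n : ℕ) : cmPowerLocus f n ⊆ cmLocus f n := by
  rintro s ⟨A₀, E, ψ, d', N, he₀, hA₀dim, hE, hd', hψ, hiso⟩
  exact ⟨A₀, he₀, hA₀dim, isOfCMType_of_isIsogenous_powSucc_of_cm hE ψ hd' hψ N hiso⟩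

/-- **Row A8 — CM-power fibres are ANCHORS, WITHOUT `HC_CM`**: `cmPowerLocus f n ⊆ anchorLocus f n` (part V's
`cmLocus_subset_anchorLocus_of_HC_CM` consumes `HC_CM`; on the CM-power locus Tate's theorem replaces it).
[cite: vanGeemen1994HodgeAV, Lemma 3.7 and Thm. 4.3] -/
theorem cmPowerLocus_subset_anchorLocus (f : 𝒳 ⟶ S) (n : ℕ) : cmPowerLocus f n ⊆ anchorLocus f n := by
  rintro s ⟨A₀, E, ψ, d', N, ⟨e₀⟩, hA₀dim, hE, hd', hψ, hiso⟩
  subst hA₀dim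
  exact mem_anchorLocus_of_chart e₀ (EllipticCurve.hodgeConjectureFor_of_isIsogenous_powSucc_of_cm hE ψ hd' hψ N hiso)

/-- F4 one-liner (owed since gen 4): a fibre charted by `A₀ ~ Eᴺ⁺¹`, `E` CM, lies in the anchor locus.
[cite: vanGeemen1994HodgeAV, Lemma 3.7 and Thm. 4.3] -/
theorem mem_anchorLocus_of_chart_of_isIsogenous_powSucc_of_cm {f : 𝒳 ⟶ S} {n : ℕ} {s : ComplexPoints S}
    (A₀ : AbelianVariety ℂ) (e₀ : A₀.X ≅ fiberOver f s) (hdim : A₀.dim = n) {E : AbelianVariety ℂ}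
    (hE : E.dim = 1) (ψ : E ⟶ E) {d : ℕ} (hd : 0 < d) (hψ : ψ ≫ ψ = -(d • 𝟙 E)) (N : ℕ)
    (hiso : A₀.IsIsogenous (E.powSucc N)) : s ∈ anchorLocus f n :=
  cmPowerLocus_subset_anchorLocus f n ⟨A₀, E, ψ, d, N, ⟨e₀⟩, hdim, hE, hd, hψ, hiso⟩

/-- At the diagonal member `A₀ = Eᴺ⁺¹` itself the CM-power chart is ALSO a divisor-generated CM chart (part VII-A's
`divisorGeneratedCMAnchor`: `Hdg = Div` on `Eᴺ⁺¹`, `EllipticCurve.hodgeClasses_divisorial_powSucc_of_cm`).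
[cite: vanGeemen1994HodgeAV, Thm. 4.3] [cite: Gordon1997, §3] -/
theorem divisorGeneratedCMAnchor_of_powSucc {E : AbelianVariety ℂ} (hE : E.dim = 1) (ψ : E ⟶ E) {d : ℕ}
    (hd : 0 < d) (hψ : ψ ≫ ψ = -(d • 𝟙 E)) (N n : ℕ) (hdim : (E.powSucc N).dim = 2 * n) {X : SchemeOver ℂ}
    (e₀ : (E.powSucc N).X ≅ X) (x : complexBetti X (2 * n)) : divisorGeneratedCMAnchor n X x :=
  ⟨E.powSucc N, ⟨e₀⟩, hdim, isOfCMType_powSucc (EllipticCurve.isOfCMType_of_cm hE ψ hd hψ) N,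
    fun y hyQ hyH ↦ EllipticCurve.hodgeClasses_divisorial_powSucc_of_cm hE ψ hd hψ N n y hyQ hyH⟩

/-- **Row D8 — `HC(A)` from (1.1) on CM-POWER-anchored Hodge families through `A`, WITHOUT `HC_CM`** (part VI's
`hodgeConjectureFor_of_HC_CM_of_invariantCycles_on_families_through` with the CM anchor specialised to a CM-power
fibre, where `HC_CM` is Tate's theorem): if every rational `(p,p)` class of `A` rides a fibrewise-Hodge global
class on a smooth projective family through `A` that satisfies Grothendieck's (1.1) and has a CM-power fibre, then
the Hodge conjecture holds for `A`. The transport input (1.1) stays the OPEN content.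
[cite: Abdulali1994FamiliesAV, (1.1) and Lemma 6.2 (p. 1131)] [cite: vanGeemen1994HodgeAV, Thm. 4.3] -/
theorem hodgeConjectureFor_of_invariantCycles_on_cmPowerAnchored_families_through (A : AbelianVariety ℂ)
    (hfam : ∀ (p : ℕ) (c : complexBetti A.X (2 * p)), IsRationalClass c →
      IsOfHodgeType A.dim A.X (2 * p) p p c →
        ∃ (𝒳 S : SchemeOver ℂ) (f : 𝒳 ⟶ S) (s₁ : ComplexPoints S) (e : A.X ≅ fiberOver f s₁)
          (W : complexBetti 𝒳 (2 * p)),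
          (∀ t : ComplexPoints S, IsRationalClass (complexBetti.map (fiberι f t) (2 * p) W) ∧
            IsOfHodgeType A.dim (fiberOver f t) (2 * p) p p (complexBetti.map (fiberι f t) (2 * p) W)) ∧
          complexBetti.map e.hom (2 * p) (complexBetti.map (fiberι f s₁) (2 * p) W) = c ∧
          InvariantCyclesHoldFor f A.dim ∧ (cmPowerLocus f A.dim).Nonempty) :
    HodgeConjectureFor A.dim A.X := by
  refine hodgeConjectureFor_of_anchoredICFamilies_through (AbelianVariety.isSmoothProjective_holds (A := A))
    fun p c hc hpp => ?_
  obtain ⟨𝒳, S, f, s₁, e, W, hW, hWc, hIC, s₀, hs₀⟩ := hfam p c hc hpp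
  exact ⟨𝒳, S, f, s₁, e, W, hW, hWc, hIC, s₀, cmPowerLocus_subset_anchorLocus f A.dim hs₀⟩

/-- **Row D8, general-fibre form — part VI's target (D1) RESTRICTED to families with a CM-POWER fibre is a
THEOREM modulo (1.1), WITHOUT `HC_CM`**: on a smooth projective family of relative dimension `n` satisfying
Grothendieck's invariant cycle statement (1.1) and having a CM-power fibre, the Hodge conjecture holds at every
Hodge-generic fibre (`HodgeClassesExtendAt`) — part V's fibre engine with the anchor supplied by row A8 (compare
`HC_GeneralFibresOfCMAnchoredFamilies_of_HC_CM`, where the CM fibre is an anchor only under `HC_CM`). The OPEN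
content is (1.1) on the family. [cite: Abdulali1994FamiliesAV, (1.1) and proof of Lemma 6.2 (p. 1131)]
[cite: vanGeemen1994HodgeAV, Thm. 4.3] -/
theorem hodgeConjectureFor_fiber_of_invariantCycles_of_cmPowerLocus_of_extend {f : 𝒳 ⟶ S} {n : ℕ}
    (hf : IsSmoothProjectiveFamily f n) (hIC : InvariantCyclesHoldFor f n) (hcp : (cmPowerLocus f n).Nonempty)
    {s : ComplexPoints S} (hs : HodgeClassesExtendAt f n s) : HodgeConjectureFor n (fiberOver f s) :=
  hodgeConjectureFor_fiber_of_invariantCycles_of_anchor_of_extend hf hIC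
    (hcp.mono (cmPowerLocus_subset_anchorLocus f n)) hs

/-! ## §2 The CM-power-pointed family leaf of the component `(ℚ(√-d), 2n, δ)` and its rows -/

/-- **`CMPowerPointedWeilFamiliesComponent n d δ` — `(ℚ(√-d), 2n, δ)`-Weil families pointed at a CM-POWER member
(typed missing input; NOT a Literature fact; NOT a case of HC, hence no on-path lemma).** Part VII-A's
`PointedWeilFamiliesComponent` with the anchor `cmPowerAnchor n`: through every `(A, φ)` of the component carrying
a non-zero rational `(n,n)` Weil class passes a δ-charted Weil family one of whose fibres is charted by an abelian
variety isogenous to `Eᴺ⁺¹`, `E` a CM elliptic curve. In print for the components containing an `E_K`-power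
member (4.10: every polarized abelian variety of Weil type is a member of an `n²`-dimensional such family; that
EVERY such family has an `E_K^{2n}`-isogenous member — `τ = i·I ∈ H_A` in 5.12, a `K`-rational positive `V₊` in
5.5–5.8 — is this layer's INFERENCE from van Geemen's construction, see the module docstring, not a printed
sentence); as a formal statement NOT claimed here for any `δ`: it is the typed leaf.
[cite: vanGeemen1994HodgeAV, 4.10, 5.8 and 5.12] [cite: Deligne1982HodgeCycles, §4, proof of Thm. 4.8 (a)–(c) and §5]
[status: open] -/
@[conjecture] def CMPowerPointedWeilFamiliesComponent (n d : ℕ) (δ : weilNormResidueGroup d) : Prop :=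
  PointedWeilFamiliesComponent n d δ (cmPowerAnchor n)

/-- **Row W1‴ — the class target of the component `(ℚ(√-d), 2n, δ)` WITHOUT `HC_CM`**, from CM-power-pointed
δ-families and the δ-restricted Weil-confined variational Hodge statement: the abstract-anchor engine of part VII-A
with the anchor validated by Tate's theorem (row V8). HONEST COLUMN: `HC_CM` is DISCHARGED (a theorem at the
anchor), the content is `WeilVariationalHodgeComponent n d δ`, OPEN, plus the pointed family leaf.
[cite: Markman2025SecantWeil, Thm. 1.5.1 (strategy; preprint, unrefereed)] [cite: vanGeemen1994HodgeAV, Thm. 4.3 and 5.12] -/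
theorem weilClassesComponent_of_cmPowerPointed {n d : ℕ} {δ : weilNormResidueGroup d}
    (hP : CMPowerPointedWeilFamiliesComponent n d δ) (hV : WeilVariationalHodgeComponent n d δ) :
    WeilClassesComponent n d δ :=
  weilClassesComponent_of_pointed_of_variational (cmPowerAnchor_valid n) hP hV

/-- **Row W6‴ — T6 of the component WITHOUT `HC_CM`**: the Hodge conjecture for the general member of
`(ℚ(√-d), 2n, δ)` from CM-power-pointed δ-families, the δ-restricted variational statement and Thm. 6.12.
[cite: vanGeemen1994HodgeAV, Thm. 6.12 and Thm. 4.3] -/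
theorem hodgeGeneralWeilTypeComponent_of_cmPowerPointed (h612 : VanGeemen1994_thm612) {n d : ℕ}
    {δ : weilNormResidueGroup d} (hn : 0 < n) (hd : 0 < d) (hP : CMPowerPointedWeilFamiliesComponent n d δ)
    (hV : WeilVariationalHodgeComponent n d δ) : HodgeGeneralWeilTypeComponent n d δ :=
  hodgeGeneralWeilTypeComponent_of_weilClassesComponent h612 hn hd (weilClassesComponent_of_cmPowerPointed hP hV)

/-- Bookkeeping: a CM-power-pointed δ-family is a CM-pointed δ-family (row C8; no `HC_CM`). [cite: Milne1999, §2 p. 54] -/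
theorem cmPointedWeilFamiliesComponent_of_cmPowerPointed {n d : ℕ} {δ : weilNormResidueGroup d}
    (hP : CMPowerPointedWeilFamiliesComponent n d δ) : CMPointedWeilFamiliesComponent n d δ :=
  PointedWeilFamiliesComponent.mono (fun _ _ h ↦ cmAnchor_of_cmPowerAnchor h) hP

/-- Bookkeeping: a CM-power-pointed δ-family is an ANCHORED δ-family — WITHOUT `HC_CM` (contrast part VII-A's
`anchoredWeilFamiliesComponent_of_HC_CM_of_cmPointed`). [cite: vanGeemen1994HodgeAV, Thm. 4.3] -/
theorem anchoredWeilFamiliesComponent_of_cmPowerPointed {n d : ℕ} {δ : weilNormResidueGroup d}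
    (hP : CMPowerPointedWeilFamiliesComponent n d δ) : AnchoredWeilFamiliesComponent n d δ := by
  intro A φ hAdim hX hφ e a haQ ha0 hδ c hcQ hcH hc hc0
  obtain ⟨𝒳, S, f, s₁, s₀, ι, W, hf, h𝒳, hS, hirrS, hsm, hW, hch, hread, hanch⟩ :=
    hP A φ hAdim hX hφ e a haQ ha0 hδ c hcQ hcH hc hc0
  exact ⟨𝒳, S, f, s₁, s₀, ι, W, hf, h𝒳, hS, hirrS, hsm, hW, hch, hread,
    cmPowerAnchor_valid n _ _ hanch (hW s₀).1 (hW s₀).2⟩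

/-- The three `HC_CM`-free routes to the class target of a component agree in shape: W1‴ factors through W1″
(anchored ∧ variational). [cite: Markman2025SecantWeil, Thm. 1.5.1 (strategy; preprint, unrefereed)] -/
theorem weilClassesComponent_of_cmPowerPointed' {n d : ℕ} {δ : weilNormResidueGroup d}
    (hP : CMPowerPointedWeilFamiliesComponent n d δ) (hV : WeilVariationalHodgeComponent n d δ) :
    WeilClassesComponent n d δ :=
  weilClassesComponent_of_anchored_of_variational (anchoredWeilFamiliesComponent_of_cmPowerPointed hP) hV

end Summit.HodgeConjecture.HodgeConjecture.Ring2.Hypotheses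

end
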